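import Literature.NumberTheory.Automorphic.GLnPlacesSplitting
import Literature.NumberTheory.Automorphic.HilbertRepCompactModCenterType
import HarnessLib

/-!
# The compressions `E R(ι_S a) E` of a product of per-place idempotents act by scalars on each
# cuspidal constituent
(Gelbart, *Automorphic forms on adele groups* (1975), §10, pp. 151–153: `ξ_S = ⊗_{v ∈ S} ξ_v`,
`R(ξ_S) R(k_S) R(ξ_S)` acting on `M ∩ V^i` through the local types; Jacquet–Langlands, LNM 114
(1970), §16, pp. 496–503)

Topic `NumberTheory/Automorphic`; theorems only (no definition, no named fact, no instance). Part
of the inline (D-0026) decomposition of the named fact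
`Literature.NumberTheory.Automorphic.multiplicity_one_quaternionUnits K D` (`JacquetLanglandsParts`,
Gelbart Thm. 10.10), types route. The multiplicity-freeness theorem
`submodule_eq_of_cuspidalSliceEquiv` (`CuspidalSliceMultiplicityFree`) takes as hypothesis `hEK`
that for every cuspidal constituent `Π` and every `a ∈ G_S = ∏_{v ∈ S} GL_n(K_v)` the operator
`E R(ι_S a)` acts on the `E`-fixed vectors of `Π` by a scalar. For `E = ∏_{v ∈ S} E_v` a product
of commuting per-place idempotents, each commuting with the local groups at the other places and
each satisfying the **local identity** `E_v R(ι_v g) E_v = c • R(z) E_v` with `z` central in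
`GL_n(𝔸_K)` (for the minimal idempotent of a cuspidal type: `comp_map_comp_eq_of_cuspidalType`,
`CuspidalTypeSupport`, with `z = ι_v(ϖ^a · 1)`, central by `GLn.toAdelic_mem_center_of_scalar`
below), this file proves `hEK`:

* `noncommProd_mul_noncommProd_mul_eq_smul` — **abstract product lemma** in an algebra: for
  commuting families `(E_i)`, `(T_i)`, `(Z_i)` with `E_i` commuting with `T_j`, `Z_j` (`j ≠ i`
  for `T`) and `E_i T_i E_i = c_i (Z_i E_i)`, one has
  `(∏ E) (∏ T) (∏ E) = (∏ c_i) ((∏ Z) (∏ E))` (`Finset.noncommProd`).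
* `GLn.ofLocal_mem_center_of_scalar`, `GLn.toAdelic_mem_center_of_scalar` — `ι_v(z)` is
  central in `GL_n(𝔸_K)` for a scalar matrix `z ∈ GL_n(K_v)`.
* `exists_noncommProd_comp_rightRegular_toAdelicPi_eq_smul` — for per-place operators `E_v` on
  `L²` as above, `E R(ι_S a) E = c R(z) E` with `z` central, `E = ∏_v E_v`.
* `exists_apply_rightRegular_toAdelicPi_eq_smul_of_isTopIrreducible` — **the hypothesis `hEK`**:
  on every irreducible (e.g. cuspidal) constituent `Π` (where the centre acts by scalars,
  `ClosedSubrep.exists_apply_eq_smul_of_mem_center`), `E R(ι_S a) y = c_Π(a) y` for `E`-fixed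
  `y ∈ Π`.

## References

* S. Gelbart, *Automorphic forms on adele groups*, Ann. of Math. Studies 83 (1975), §10,
  pp. 151–153 [Gelbart1975].
* H. Jacquet, R. P. Langlands, *Automorphic forms on GL(2)*, LNM 114 (1970), §16, pp. 496–503
  [JacquetLanglands1970].
-/

noncomputable section

open scoped InnerProductSpace
open NumberField IsDedekindDomain MeasureTheory ContRepresentation

namespace Literature.NumberTheory.Automorphic

/-! ### The abstract product lemma -/

section ProductLemma

variable {A : Type*} [Ring A] [Algebra ℂ A] {ι : Type*}

/-- **Compressions of products of commuting idempotents.** In a `ℂ`-algebra let `(E_i)`, `(T_i)`,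
`(Z_i)` be pairwise commuting families such that `E_i` commutes with `T_j` for `j ≠ i` and with
every `Z_j`, and suppose `E_i T_i E_i = c_i (Z_i E_i)` for `i ∈ s`. Then
`(∏_{i ∈ s} E_i) (∏ T_i) (∏ E_i) = (∏ c_i) ((∏ Z_i) (∏ E_i))`. [folklore] -/
theorem noncommProd_mul_noncommProd_mul_eq_smul [DecidableEq ι] (s : Finset ι) (Ef T Z : ι → A)
    (c : ι → ℂ) (hEE : ∀ i j, Commute (Ef i) (Ef j)) (hTT : ∀ i j, Commute (T i) (T j))
    (hZZ : ∀ i j, Commute (Z i) (Z j)) (hET : ∀ i j, i ≠ j → Commute (Ef i) (T j))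
    (hEZ : ∀ i j, Commute (Ef i) (Z j))
    (hloc : ∀ i ∈ s, Ef i * T i * Ef i = c i • (Z i * Ef i)) :
    s.noncommProd Ef (fun i _ j _ _ => hEE i j) * s.noncommProd T (fun i _ j _ _ => hTT i j) *
        s.noncommProd Ef (fun i _ j _ _ => hEE i j) =
      (∏ i ∈ s, c i) •
        (s.noncommProd Z (fun i _ j _ _ => hZZ i j) * s.noncommProd Ef (fun i _ j _ _ => hEE i j)) := by
  induction s using Finset.induction_on with
  | empty => simp
  | @insert i s hi ih =>
    have hloc' : ∀ j ∈ s, Ef j * T j * Ef j = c j • (Z j * Ef j) := fun j hj =>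
      hloc j (Finset.mem_insert_of_mem hj)
    have hi' : Ef i * T i * Ef i = c i • (Z i * Ef i) := hloc i (Finset.mem_insert_self i s)
    set A' := s.noncommProd Ef (fun i _ j _ _ => hEE i j) with hA'
    set B' := s.noncommProd T (fun i _ j _ _ => hTT i j) with hB'
    set C' := s.noncommProd Z (fun i _ j _ _ => hZZ i j) with hC'
    have ih' : A' * B' * A' = (∏ j ∈ s, c j) • (C' * A') := ih hloc'
    -- commutations of the new factors with the old products
    have hne : ∀ j ∈ s, i ≠ j := fun j hj h => hi (h ▸ hj)
    have hTA : Commute (T i) A' :=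
      Finset.noncommProd_commute s Ef _ (T i) fun j hj => (hET j i (hne j hj).symm).symm
    have hEA : Commute (Ef i) A' := Finset.noncommProd_commute s Ef _ (Ef i) fun j _ => hEE i j
    have hEB : Commute (Ef i) B' :=
      Finset.noncommProd_commute s T _ (Ef i) fun j hj => hET i j (hne j hj)
    have hEC : Commute (Ef i) C' := Finset.noncommProd_commute s Z _ (Ef i) fun j _ => hEZ i j
    rw [Finset.noncommProd_insert_of_notMem _ _ _ _ hi,
      Finset.noncommProd_insert_of_notMem _ _ _ _ hi,
      Finset.noncommProd_insert_of_notMem _ _ _ _ hi, Finset.prod_insert hi]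
    calc Ef i * A' * (T i * B') * (Ef i * A')
        = Ef i * T i * Ef i * (A' * B' * A') := by
          simp only [mul_assoc]
          rw [← hTA.left_comm, ← hEB.left_comm, ← hEA.left_comm]
      _ = (c i • (Z i * Ef i)) * ((∏ j ∈ s, c j) • (C' * A')) := by rw [hi', ih']
      _ = (c i * ∏ j ∈ s, c j) • (Z i * C' * (Ef i * A')) := by
          rw [smul_mul_smul_comm]
          simp only [mul_assoc]
          rw [hEC.left_comm]

end ProductLemma

/-! ### Scalars at a place are central in `GL_n(𝔸_K)` -/

section Center

variable {n : ℕ} {K : Type} [Field K] [NumberField K] {v : HeightOneSpectrum (𝓞 K)}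

/-- **`ι_v` of a scalar matrix is central in `GL_n(𝔸_K)`** (matrix form): for `z ∈ GL_n(K_v)`
with matrix `α · 1`, the matrix of `ι_v(z)` is the scalar adelic matrix `(1 + ι_v(α - 1)) · 1`.
[folklore] -/
theorem GLn.ofLocal_mem_center_of_scalar (z : GL (Fin n) (v.adicCompletion K))
    (α : v.adicCompletion K)
    (hz : ((z : GL (Fin n) (v.adicCompletion K)) : Matrix (Fin n) (Fin n) (v.adicCompletion K)) =
      Matrix.scalar (Fin n) α) :
    GLn.ofLocal n K v z ∈ Subgroup.center (GL (Fin n) (AdeleRing (𝓞 K) K)) := by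
  have hmat : ((GLn.ofLocal n K v z : GL (Fin n) (AdeleRing (𝓞 K) K)) :
      Matrix (Fin n) (Fin n) (AdeleRing (𝓞 K) K)) =
        Matrix.scalar (Fin n) (1 + adeleSingleHom K v (α - 1)) := by
    ext i j
    rw [GLn.coe_ofLocal_apply, hz]
    by_cases hij : i = j
    · subst hij
      simp [Matrix.scalar_apply]
    · simp [Matrix.scalar_apply, Matrix.one_apply_ne hij, Matrix.diagonal_apply_ne _ hij]
  rw [Subgroup.mem_center_iff]
  intro g
  refine Units.ext ?_
  rw [Units.val_mul, Units.val_mul, hmat]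
  exact (Matrix.scalar_commute _ (fun r' => Commute.all _ r')
    (g : Matrix (Fin n) (Fin n) (AdeleRing (𝓞 K) K))).symm.eq

/-- **`ι_v` of a scalar matrix is central in `GL_n(𝔸_K)`** (`GLn.toAdelic` form, on the adelic
group of the datum `AdelicGroupData.gl n K`). [folklore] -/
theorem GLn.toAdelic_mem_center_of_scalar (z : GL (Fin n) (v.adicCompletion K))
    (α : v.adicCompletion K)
    (hz : ((z : GL (Fin n) (v.adicCompletion K)) : Matrix (Fin n) (Fin n) (v.adicCompletion K)) =
      Matrix.scalar (Fin n) α) :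
    GLn.toAdelic n K v z ∈ Subgroup.center (AdelicGroupData.gl n K).Adelic :=
  GLn.ofLocal_mem_center_of_scalar z α hz

end Center

/-! ### The compressions `E R(ι_S a) E` -/

section Adelic

variable {n : ℕ} {K : Type} [Field K] [NumberField K]
  {μ : Measure (AdelicGroupData.gl n K).automorphicQuotient}
  [(AdelicGroupData.gl n K).IsAutomorphicMeasure μ]
  {S : Finset (HeightOneSpectrum (𝓞 K))}

/-- **`E R(ι_S a) E = c R(z) E` with `z` central, for a product `E = ∏_{v ∈ S} E_v` of
commuting per-place operators with the local identities `E_v R(ι_v g) E_v = c_v R(z_v) E_v`.**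
Hypotheses: the `E_v` pairwise commute; `E_v` commutes with `R(ι_w g)` for `w ≠ v`; for each
`v ∈ S` and `g ∈ GL_n(K_v)` there are `c ∈ ℂ` and a central `z ∈ GL_n(𝔸_K)` with
`E_v R(ι_v g) E_v = c (R(z) E_v)`. [cite: Gelbart1975, §10, pp. 151–153] -/
theorem exists_noncommProd_comp_rightRegular_toAdelicPi_eq_smul
    (Ef : S → ((AdelicGroupData.gl n K).L2 μ →L[ℂ] (AdelicGroupData.gl n K).L2 μ))
    (hEE : ∀ v w, Commute (Ef v) (Ef w))
    (hEι : ∀ v w : S, v ≠ w → ∀ g : GL (Fin n) ((w : HeightOneSpectrum (𝓞 K)).adicCompletion K),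
      Commute (Ef v) ((AdelicGroupData.gl n K).rightRegular μ
        (GLn.toAdelic n K (w : HeightOneSpectrum (𝓞 K)) g)))
    (hEcent : ∀ (v : S) (z : (AdelicGroupData.gl n K).Adelic),
      z ∈ Subgroup.center (AdelicGroupData.gl n K).Adelic →
      Commute (Ef v) ((AdelicGroupData.gl n K).rightRegular μ z))
    (hloc : ∀ (v : S) (g : GL (Fin n) ((v : HeightOneSpectrum (𝓞 K)).adicCompletion K)),
      ∃ (c : ℂ) (z : (AdelicGroupData.gl n K).Adelic),
        z ∈ Subgroup.center (AdelicGroupData.gl n K).Adelic ∧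
        Ef v * (AdelicGroupData.gl n K).rightRegular μ
            (GLn.toAdelic n K (v : HeightOneSpectrum (𝓞 K)) g) * Ef v =
          c • ((AdelicGroupData.gl n K).rightRegular μ z * Ef v))
    (a : GLn.LocalPi n K S) :
    ∃ (c : ℂ) (z : (AdelicGroupData.gl n K).Adelic),
      z ∈ Subgroup.center (AdelicGroupData.gl n K).Adelic ∧
      (Finset.univ : Finset S).noncommProd Ef (fun v _ w _ _ => hEE v w) *
          (AdelicGroupData.gl n K).rightRegular μ (GLn.toAdelicPi n K S a) *
          (Finset.univ : Finset S).noncommProd Ef (fun v _ w _ _ => hEE v w) =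
        c • ((AdelicGroupData.gl n K).rightRegular μ z *
          (Finset.univ : Finset S).noncommProd Ef (fun v _ w _ _ => hEE v w)) := by
  classical
  set R := (AdelicGroupData.gl n K).rightRegular μ with hR
  -- choose the local scalars and central elements
  choose c z hz hloc' using fun v : S => hloc v (a v)
  -- the families `T v = R(ι_v a_v)`, `Z v = R(z v)`
  set T : S → ((AdelicGroupData.gl n K).L2 μ →L[ℂ] (AdelicGroupData.gl n K).L2 μ) :=
    fun v => R (GLn.toAdelic n K (v : HeightOneSpectrum (𝓞 K)) (a v)) with hT
  set Zf : S → ((AdelicGroupData.gl n K).L2 μ →L[ℂ] (AdelicGroupData.gl n K).L2 μ) :=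
    fun v => R (z v) with hZf
  have hTT : ∀ v w, Commute (T v) (T w) := by
    intro v w
    by_cases hvw : v = w
    · subst hvw
      exact Commute.refl _
    · change R _ * R _ = R _ * R _
      rw [← map_mul, ← map_mul, GLn.toAdelic_comm_of_ne (fun h => hvw (Subtype.ext h)) (a v) (a w)]
  have hzcomm : ∀ (v : S) (γ : (AdelicGroupData.gl n K).Adelic), Commute (R (z v)) (R γ) := by
    intro v γ
    change R _ * R _ = R _ * R _
    rw [← map_mul, ← map_mul, ((Subgroup.mem_center_iff.1 (hz v)) γ).symm]
  have hZZ : ∀ v w, Commute (Zf v) (Zf w) := fun v w => hzcomm v (z w)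
  have hET : ∀ v w, v ≠ w → Commute (Ef v) (T w) := fun v w hvw => hEι v w hvw (a w)
  have hEZ : ∀ v w, Commute (Ef v) (Zf w) := fun v w => hEcent v (z w) (hz w)
  have key := noncommProd_mul_noncommProd_mul_eq_smul (Finset.univ : Finset S) Ef T Zf c hEE hTT
    hZZ hET hEZ (fun v _ => hloc' v)
  -- `R(ι_S a) = ∏_v R(ι_v a_v)`
  have hRT : R (GLn.toAdelicPi n K S a) =
      (Finset.univ : Finset S).noncommProd T (fun v _ w _ _ => hTT v w) := by
    rw [GLn.toAdelicPi_apply, Finset.map_noncommProd]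
  -- the central element `∏_v z_v`
  have hzz : ∀ v w, Commute (z v) (z w) := fun v w =>
    show z v * z w = z w * z v from ((Subgroup.mem_center_iff.1 (hz v)) (z w)).symm
  set ztot : (AdelicGroupData.gl n K).Adelic :=
    (Finset.univ : Finset S).noncommProd z (fun v _ w _ _ => hzz v w) with hztot
  have hztot_mem : ztot ∈ Subgroup.center (AdelicGroupData.gl n K).Adelic :=
    Subgroup.noncommProd_mem _ _ fun v _ => hz v
  have hRZ : R ztot = (Finset.univ : Finset S).noncommProd Zf (fun v _ w _ _ => hZZ v w) := by
    rw [hztot, Finset.map_noncommProd]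
  refine ⟨∏ v, c v, ztot, hztot_mem, ?_⟩
  rw [hRT, hRZ]
  exact key

/-- **The hypothesis `hEK` of `submodule_eq_of_cuspidalSliceEquiv`: on a cuspidal constituent,
`E R(ι_S a)` acts on the `E`-fixed vectors by a scalar**, for `E = ∏_{v ∈ S} E_v` as in
`exists_noncommProd_comp_rightRegular_toAdelicPi_eq_smul` (the centre of `GL_n(𝔸_K)` acts on an
irreducible constituent by scalars, `ClosedSubrep.exists_apply_eq_smul_of_mem_center`).
[cite: Gelbart1975, §10, pp. 151–153] -/
theorem exists_apply_rightRegular_toAdelicPi_eq_smul_of_isTopIrreducible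
    (Ef : S → ((AdelicGroupData.gl n K).L2 μ →L[ℂ] (AdelicGroupData.gl n K).L2 μ))
    (hEE : ∀ v w, Commute (Ef v) (Ef w))
    (hEι : ∀ v w : S, v ≠ w → ∀ g : GL (Fin n) ((w : HeightOneSpectrum (𝓞 K)).adicCompletion K),
      Commute (Ef v) ((AdelicGroupData.gl n K).rightRegular μ
        (GLn.toAdelic n K (w : HeightOneSpectrum (𝓞 K)) g)))
    (hEcent : ∀ (v : S) (z : (AdelicGroupData.gl n K).Adelic),
      z ∈ Subgroup.center (AdelicGroupData.gl n K).Adelic →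
      Commute (Ef v) ((AdelicGroupData.gl n K).rightRegular μ z))
    (hloc : ∀ (v : S) (g : GL (Fin n) ((v : HeightOneSpectrum (𝓞 K)).adicCompletion K)),
      ∃ (c : ℂ) (z : (AdelicGroupData.gl n K).Adelic),
        z ∈ Subgroup.center (AdelicGroupData.gl n K).Adelic ∧
        Ef v * (AdelicGroupData.gl n K).rightRegular μ
            (GLn.toAdelic n K (v : HeightOneSpectrum (𝓞 K)) g) * Ef v =
          c • ((AdelicGroupData.gl n K).rightRegular μ z * Ef v))
    (W : ClosedSubrep ((AdelicGroupData.gl n K).rightRegular μ))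
    (hW : W.toContRep.IsTopIrreducible) (a : GLn.LocalPi n K S) :
    ∃ c : ℂ, ∀ y ∈ W,
      (Finset.univ : Finset S).noncommProd Ef (fun v _ w _ _ => hEE v w) y = y →
      (Finset.univ : Finset S).noncommProd Ef (fun v _ w _ _ => hEE v w)
          ((AdelicGroupData.gl n K).rightRegular μ (GLn.toAdelicPi n K S a) y) = c • y := by
  have hRu : IsUnitary ((AdelicGroupData.gl n K).rightRegular μ) :=
    (AdelicGroupData.gl n K).isUnitary_rightRegular μ
  obtain ⟨c, z, hz, h⟩ :=
    exists_noncommProd_comp_rightRegular_toAdelicPi_eq_smul Ef hEE hEι hEcent hloc a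
  obtain ⟨ω, hω⟩ := ClosedSubrep.exists_apply_eq_smul_of_mem_center hRu hW hz
  refine ⟨c * ω, fun y hy hEy => ?_⟩
  have h1 := DFunLike.congr_fun h y
  simp only [ContinuousLinearMap.mul_def, ContinuousLinearMap.coe_comp, Function.comp_apply,
    FunLike.coe_smul, Pi.smul_apply] at h1
  rw [hEy, hω y hy, smul_smul] at h1
  exact h1

end Adelic



end Literature.NumberTheory.Automorphic
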